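import Literature.MathematicalPhysics.QuantumFieldTheory.Dimock2011to13.BlockAveragingMatrix
import Literature.MathematicalPhysics.QuantumFieldTheory.Dimock2011to13.Reblocking

/-!
# Dimock, *The renormalization group according to Balaban* I, §2.1 L317–336: the block-averaging operator `Q` ON THE
# TORUS — the cubes `B(y)` of the cell's torus model have EXACTLY `L^d` sites, so `QQᵀ = I`, `QᵀQ` = the projection onto
# the block-constant functions and `Qmat·Qmatᵀ = 1` hold for the CONCRETE cube geometry (instance of `BlockAveragingMatrix`)

**Citation header (reproduction of PUBLISHED work; template of the Bałaban lattice Yang–Mills cell).**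
J. Dimock, *The renormalization group according to Balaban I. Small fields*, Rev. Math. Phys. **25** (2013) 1330010
(= arXiv:1108.1335v2) [Dimock2013], §2.1 TeX L317–336 (TeX source held by the cell,
`inputs/files/dimock/src/1108.1335/1108.1335.tex`, 7382e6540dded9be).  Dimock's papers are published and refereed and
are the cell's TEMPLATE, not manuscripts under audit; no quantity of the Bałaban series is touched.

**What the paper prints (verbatim).**  L317–327: *"On the lattice L^{−k}ℤ³, or any associated toroidal lattice, the
averaging operator Q takes functions f on L^{−k}ℤ³ to functions Qf on L^{−k+1}ℤ³ by (Qf)(y) = L^{−3} Σ_{x∈B(y)} f(x)  Here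
B(y) is cubes of L³ sites (L on a side) in L^{−k}ℤ³ centered on y ∈ L^{−k+1}ℤ³. … and we assume L is odd."*  L328–336:
*"The transpose operator Qᵀ … is computed to be (Qᵀf)(x) = f(y) if x ∈ B(y)  Then QQᵀ = I while QᵀQ is a projection
operator onto the range of Qᵀ which is functions constant on the cubes."*

**Why this module.**  `BlockAveragingMatrix` (this lineage, v1 p203077) proves the §2.1 operator statements for EVERY
block map `b : ι → σ` whose fibres have a common size `N > 0`, and records as NOT reproduced *"the cube geometry as a
concrete Fintype instance beyond §4's example"*; `Reblocking` (this lineage, p183285) has the cell's torus block map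
`tcoarse L N′ : TPt d (L·N′) → TPt d N′` (pv22's `TreeLengthTorusTransfer`: `x ↦ ⌊x/L⌋ mod N′` on `(ℤ/LN′)^d`) with the
fibre bound `card_filter_tcoarse_eq_le : #B(y) ≤ L^d`, its docstring saying *"at most (in fact exactly) L^d"*.  This
module proves the EXACT count and thereby instantiates all of §2.1 on the torus.

**What is reproduced here (kernel-checked, zero `sorry`).**
* §1 `cubeBox L N′ y` — the `L^d` integer points `x` with `L·ȳ_i ≤ x_i < L·ȳ_i + L` (`ȳ = natLift y` the representative
  of `y` in `[0, N′)^d`); `card_cubeBox : #cubeBox = L^d`; `fibre_tcoarse_eq : B(y) = proj(cubeBox y)` (the fibre of the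
  block map IS the projected cube: `⊆` by pv11's `coarse_eq_iff`, `⊇` by `tcoarse_proj`); `proj_injOn_cubeBox` (the cube
  lies in the fundamental box `[0, LN′)^d`, where `proj` is injective; private); hence **`card_fibre_tcoarse : #B(y) = L^d`** —
  *"B(y) is cubes of L³ sites (L on a side)"*.
* §2 THE INSTANCE: with `Qt L N′ := Qmat (tcoarse L N′) (L^d)`, **`Qt_mul_transpose : Qt * Qtᵀ = 1`** (*"QQᵀ = I"* on the
  torus, in the isometric normalisation of this lineage's one-step modules — their hypothesis `hQ` for the torus cube
  geometry, every `d`, `L ≥ 1`, `N′ ≥ 1`), `torus_QD_QDT` (the printed `QQᵀ = I`: `QD (QDT g) = g` with `N = L^d`),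
  `torus_proj_eq_self_iff` (*"QᵀQ is a projection operator onto … functions constant on the cubes"*: the fixed points of
  `QᵀQ` are exactly the functions constant on the cubes of the torus), `torus_QD_apply` (the printed formula
  `(Qf)(y) = L^{−d} Σ_{x∈B(y)} f(x)`).
* §3 instance `d = 1`, `L = 3`, `N′ = 2` (the circle `ℤ/6` over `ℤ/2`).

**Readings (declared).**  (i) CORNER CONVENTION: the cell's torus model labels the cube of `y` by `⌊x/L⌋ = ȳ` (corner at
`L·ȳ`), the print centres `B(y)` on `y` with `L` odd — the two differ by the relabelling `x ↦ x + (L−1)/2` of the fine torus,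
under which fibre sizes and all of §2.1's algebra are invariant (cell ruling F3 of `HOME/NOTATION.md` §2.3 records the
corner ∕ centre conventions of B4 (1.1), N4 (19), B12 (0.1) and D1); nothing here depends on parity of `L`.  (ii) Integer
coordinates (`TPt d n = (ℤ/n)^d`, spacing 1) in place of `L^{−k}ℤ³ ∩` torus: scale invariance of `Q` (L404) makes this a
relabelling.  (iii) Every `d`; the print has `d = 3`.

**What is NOT claimed.**  Composition `Q_k = Q^k` on the torus as an equality of `tcoarse` maps across the types
`TPt d (L·(L·N′))` ∕ `TPt d ((L·L)·N′)` (propositionally but not definitionally equal moduli; the composition law is kernel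
in the abstract form `BlockAveragingMatrix.Qmat_comp` and in the function form on `ℤ^d`, `BlockAveragingComposition.qavg_comp`);
the scaled densities and normalisations L406–435; anything of B1–B16.  NOT summit progress; NOT a statement about any
Bałaban paper; NOT continuum; NOT Clay.  Unit `b2b-balaban-template` gen 31 (journal CLAIM D1-TORUS-BLOCK-AVERAGING-KERNEL).

**Version.**  v1.
-/

noncomputable section

open Finset Matrix
open Literature.MathematicalPhysics.QuantumFieldTheory.Balaban1983to89.B13ScaleTransfer (Pt coarse coarse_eq_iff)
open Literature.MathematicalPhysics.QuantumFieldTheory.Balaban1983to89.TreeLengthTorus (TPt proj natLift proj_natLift)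
open Literature.MathematicalPhysics.QuantumFieldTheory.Balaban1983to89.TreeLengthTorusTransfer (tcoarse tcoarse_proj)
open Literature.MathematicalPhysics.QuantumFieldTheory.Dimock2011to13.BlockAveragingMatrix
open Literature.MathematicalPhysics.QuantumFieldTheory.Dimock2011to13.Reblocking (natLift_proj_of_mem_box)

namespace Literature.MathematicalPhysics.QuantumFieldTheory.Dimock2011to13.TorusBlockAveraging

variable {d : ℕ} (L N' : ℕ) [NeZero L] [NeZero N']

/-! ## §1 The cubes of the torus have exactly `L^d` sites -/

/-- the cube of side `L` with corner `L·ȳ` in integer coordinates: the points `x ∈ ℤ^d` with `L ȳ_i ≤ x_i < L ȳ_i + L`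
(`ȳ = natLift y ∈ [0, N′)^d`). [cite: Dimock2013, §2.1 L322–326 (arXiv:1108.1335v2 TeX)] -/
def cubeBox (y : TPt d N') : Finset (Pt d) :=
  Fintype.piFinset fun i => Finset.Ico ((L : ℤ) * natLift y i) ((L : ℤ) * natLift y i + L)

omit [NeZero L] [NeZero N'] in
/-- *"cubes of L³ sites (L on a side)"*: `#cubeBox = L^d`. [cite: Dimock2013, §2.1 L322–323 (arXiv:1108.1335v2 TeX)] -/
theorem card_cubeBox (y : TPt d N') : (cubeBox L N' y).card = L ^ d := by
  rw [cubeBox, Fintype.card_piFinset]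
  simp only [Int.card_Ico, add_sub_cancel_left, Int.toNat_natCast, prod_const, card_univ, Fintype.card_fin]

variable {L N'}

omit [NeZero N'] in
/-- coordinates of a representative are non-negative. [folklore] -/
private theorem natLift_nonneg (a : TPt d N') (i : Fin d) : 0 ≤ natLift a i := by
  show (0 : ℤ) ≤ ((a i).val : ℤ)
  exact Int.natCast_nonneg _

/-- coordinates of a representative are `< N′`. [folklore] -/
private theorem natLift_lt (a : TPt d N') (i : Fin d) : natLift a i < N' := by
  have := ZMod.val_lt (a i)
  show ((a i).val : ℤ) < N'
  exact_mod_cast this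

omit [NeZero N'] in
/-- a point of the cube has its block index equal to `ȳ`: `coarse L x = natLift y`. [folklore] -/
private theorem coarse_eq_of_mem_cubeBox {y : TPt d N'} {x : Pt d} (hx : x ∈ cubeBox L N' y) :
    coarse L x = natLift y := by
  have hL : 0 < L := Nat.pos_of_ne_zero (NeZero.ne L)
  rw [coarse_eq_iff hL]
  intro i
  rw [cubeBox, Fintype.mem_piFinset] at hx
  have hi := Finset.mem_Ico.mp (hx i)
  constructor
  · exact hi.1
  · linarith [hi.2]

/-- a point of the cube lies in the fundamental box `[0, LN′)^d`. [folklore] -/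
private theorem mem_box_of_mem_cubeBox {y : TPt d N'} {x : Pt d} (hx : x ∈ cubeBox L N' y) (i : Fin d) :
    0 ≤ x i ∧ x i < (L : ℤ) * N' := by
  have hL : 0 < L := Nat.pos_of_ne_zero (NeZero.ne L)
  have hLz : (0 : ℤ) ≤ L := by exact_mod_cast hL.le
  rw [cubeBox, Fintype.mem_piFinset] at hx
  have hi := Finset.mem_Ico.mp (hx i)
  constructor
  · exact le_trans (mul_nonneg hLz (natLift_nonneg y i)) hi.1
  · have h1 : natLift y i + 1 ≤ N' := by linarith [natLift_lt y i]
    calc x i < (L : ℤ) * natLift y i + L := hi.2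
      _ = (L : ℤ) * (natLift y i + 1) := by ring
      _ ≤ (L : ℤ) * N' := mul_le_mul_of_nonneg_left h1 hLz

/-- **the fibre of the torus block map over `y` IS the projected cube**: `B(y) = proj_{LN′}(cubeBox y)`.
[cite: Dimock2013, §2.1 L322–326 (arXiv:1108.1335v2 TeX)] -/
theorem fibre_tcoarse_eq (y : TPt d N') :
    fibre (tcoarse L N') y = (cubeBox L N' y).image (proj (L * N')) := by
  classical
  have hL : 0 < L := Nat.pos_of_ne_zero (NeZero.ne L)
  have hLz : (0 : ℤ) < L := by exact_mod_cast hL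
  ext a
  rw [mem_fibre, mem_image]
  constructor
  · intro ha
    refine ⟨natLift a, ?_, proj_natLift a⟩
    have hx0 : ∀ i, 0 ≤ natLift a i := natLift_nonneg a
    have hxN : ∀ i, natLift a i < (L : ℤ) * N' := fun i => by
      have := natLift_lt a i
      push_cast at this
      exact this
    have hc0 : ∀ i, 0 ≤ coarse L (natLift a) i := fun i => Int.ediv_nonneg (hx0 i) hLz.le
    have hcN : ∀ i, coarse L (natLift a) i < N' := fun i => by
      show natLift a i / (L : ℤ) < N'
      rw [Int.ediv_lt_iff_lt_mul hLz]
      linarith [hxN i, mul_comm (L : ℤ) (N' : ℤ)]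
    have hcb : coarse L (natLift a) = natLift y := by
      have h1 : proj N' (coarse L (natLift a)) = y := by
        have := tcoarse_proj (L := L) (N' := N') (natLift a)
        rw [proj_natLift] at this
        rw [← this, ha]
      rw [← natLift_proj_of_mem_box hc0 hcN, h1]
    have hbox := (coarse_eq_iff hL (natLift a) (natLift y)).1 hcb
    rw [cubeBox, Fintype.mem_piFinset]
    intro i
    rw [Finset.mem_Ico]
    refine ⟨(hbox i).1, ?_⟩
    linarith [(hbox i).2]
  · rintro ⟨x, hx, rfl⟩
    rw [tcoarse_proj, coarse_eq_of_mem_cubeBox hx, proj_natLift]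

/-- `proj_{LN′}` is injective on the cube (it lies in the fundamental box). [folklore] -/
private theorem proj_injOn_cubeBox (y : TPt d N') : Set.InjOn (proj (L * N')) (cubeBox L N' y : Set (Pt d)) := by
  intro x hx x' hx' h
  have hx1 := mem_box_of_mem_cubeBox (Finset.mem_coe.mp hx)
  have hx2 := mem_box_of_mem_cubeBox (Finset.mem_coe.mp hx')
  have e1 : natLift (proj (L * N') x) = x :=
    natLift_proj_of_mem_box (fun i => (hx1 i).1) (fun i => by exact_mod_cast (hx1 i).2)
  have e2 : natLift (proj (L * N') x') = x' :=
    natLift_proj_of_mem_box (fun i => (hx2 i).1) (fun i => by exact_mod_cast (hx2 i).2)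
  rw [← e1, ← e2, h]

/-- **`#B(y) = L^d` EXACTLY** for the torus block map `tcoarse L N′` — *"B(y) is cubes of L³ sites (L on a side)"*; sharpens
`Reblocking.card_filter_tcoarse_eq_le` (`≤`). [cite: Dimock2013, §2.1 L322–323 (arXiv:1108.1335v2 TeX)] -/
theorem card_fibre_tcoarse (y : TPt d N') : (fibre (tcoarse L N') y).card = L ^ d := by
  rw [fibre_tcoarse_eq, Finset.card_image_of_injOn (proj_injOn_cubeBox y), card_cubeBox]

/-! ## §2 The instance: §2.1 on the torus -/

variable (L N')

/-- the one-step block-averaging matrix of the torus `(ℤ/LN′)^d → (ℤ/N′)^d` in the isometric normalisation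
(`= BlockAveragingMatrix.Qmat` of the cube geometry, `N = L^d`). [cite: Dimock2013, §2.1 L317–321 (arXiv:1108.1335v2 TeX)] -/
def Qt : Matrix (TPt d N') (TPt d (L * N')) ℝ := Qmat (tcoarse L N') (L ^ d)

/-- **`QQᵀ = I` ON THE TORUS** (isometric form): `Qt * Qtᵀ = 1` — the hypothesis `hQ : Q * Qᵀ = 1` of `FreeFlowSingleStep` ∕
`GaussianSingleStep` ∕ `LocalizedSingleStep` ∕ `MultiRegionFreeFlow` DISCHARGED for the torus cube geometry, every `d`, `L`,
`N′`. [cite: Dimock2013, §2.1 L335 (arXiv:1108.1335v2 TeX)] -/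
theorem Qt_mul_transpose : Qt L N' * (Qt L N')ᵀ = (1 : Matrix (TPt d N') (TPt d N') ℝ) :=
  Qmat_mul_transpose card_fibre_tcoarse (pow_pos (Nat.pos_of_ne_zero (NeZero.ne L)) d)

/-- **the printed `QQᵀ = I` on the torus**: `QD (QDT g) = g` with `N = L^d`. [cite: Dimock2013, §2.1 L335 (arXiv:1108.1335v2
TeX)] -/
theorem torus_QD_QDT (g : TPt d N' → ℝ) : QD (tcoarse L N') (L ^ d) (QDT (tcoarse L N') g) = g :=
  QD_QDT card_fibre_tcoarse (pow_pos (Nat.pos_of_ne_zero (NeZero.ne L)) d) g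

/-- **`QᵀQ` on the torus is the projection onto the functions constant on the cubes**: its fixed points are exactly the
`f` with `f x = f x′` whenever `x`, `x′` lie in the same cube. [cite: Dimock2013, §2.1 L335–336 (arXiv:1108.1335v2 TeX)] -/
theorem torus_proj_eq_self_iff (f : TPt d (L * N') → ℝ) :
    QDT (tcoarse L N') (QD (tcoarse L N') (L ^ d) f) = f ↔
      ∀ x x', tcoarse L N' x = tcoarse L N' x' → f x = f x' :=
  proj_eq_self_iff card_fibre_tcoarse (pow_pos (Nat.pos_of_ne_zero (NeZero.ne L)) d) f

/-- **the printed formula** `(Qf)(y) = L^{−d} Σ_{x∈B(y)} f(x)` on the torus, the sum running over the `L^d` sites of the cube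
of `y`. [cite: Dimock2013, §2.1 L317–321 (arXiv:1108.1335v2 TeX)] -/
theorem torus_QD_apply (f : TPt d (L * N') → ℝ) (y : TPt d N') :
    QD (tcoarse L N') (L ^ d) f y = ((L : ℝ) ^ d)⁻¹ * ∑ x ∈ fibre (tcoarse L N') y, f x := by
  simp [QD]

/-- the isometric and the printed normalisation differ by `√(L^d)` on the torus: `Qt f (y) = (√(L^d))⁻¹ Σ_{x∈B(y)} f(x)`.
[cite: Dimock2013, §2.1 L317–321 (arXiv:1108.1335v2 TeX)] -/
theorem Qt_mulVec (f : TPt d (L * N') → ℝ) (y : TPt d N') :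
    (Qt L N' *ᵥ f) y = (√((L : ℝ) ^ d))⁻¹ * ∑ x ∈ fibre (tcoarse L N') y, f x := by
  rw [Qt, Qmat_mulVec]; push_cast; rfl

/-! ## §3 Instance -/

/-- the circle `ℤ/6` over `ℤ/2` with cubes of `3` sites (`d = 1`, `L = 3`, `N′ = 2`): `Qt * Qtᵀ = 1`. -/
example : Qt (d := 1) 3 2 * (Qt (d := 1) 3 2)ᵀ = 1 := Qt_mul_transpose 3 2

/-- … and every cube of that circle has exactly `3 = 3¹` sites. -/
example (y : TPt 1 2) : (fibre (tcoarse 3 2) y).card = 3 ^ 1 := card_fibre_tcoarse y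

end Literature.MathematicalPhysics.QuantumFieldTheory.Dimock2011to13.TorusBlockAveraging

end
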